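import Mathlib
import Literature.NumberTheory.Irrationality.LaiSprangZudilin2026.PartialFractions
import Literature.NumberTheory.Irrationality.PAdicZetaValues.VolkenbornDeltaOperator
import HarnessLib

/-!
# Lai–Sprang–Zudilin 2026, §3: the 2-adic linear forms `S_n = −∫_{ℤ₂} R_n′(t+½)dt = ρ_{n,0} + ρ_{n,3}·ζ₂(5)` (Lemma 3.3) — PROVED

Topic `Literature/NumberTheory/Irrationality/LaiSprangZudilin2026`.  Source: L. Lai, J. Sprang, W. Zudilin, *A note on the
irrationality of `ζ₂(5)`*, IMRN **2026**:16, rnag180 = arXiv:2505.05005 [LaiSprangZudilin2026], §3 "Rational functions and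
linear forms" (held text `paper:arxiv-2505.05005`, chunk p0006, read on the page).  PROOF FILE (theorems + three definitions
with bodies; no named fact, net debt 0); file 2 of the tree's discharge of [LaiSprangZudilin2026, Thm 1.1] (`ζ₂(5) ∉ ℚ`).

## Source, as printed

* Definition 3.1 `R_n(t) := 2^{8n}(2t+n)(t+½)_n⁴/(t)_{n+1}⁴` (tree: `R`), (3.1) `deg R_n = −3`, (def_rik)
  `R_n(t) =: Σ_{i=1}^{4}Σ_{k=0}^{n} r_{n,i,k}/(t+k)^i` (tree: `coeffR`, `R_eq_sum_coeffR`).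
* **Definition 3.2.** "`S_n := −∫_{ℤ₂} R_n′(t+½) dt`, where `R_n′(t)` is the derivative function of `R_n(t)`."
* **Lemma 3.3.** "For any `n ∈ ℤ_{≥0}`, we have `S_n = ρ_{n,0} + ρ_{n,3}·ζ₂(5)`, where
  `ρ_{n,0} = −Σ_{i=1}^{4}Σ_{k=0}^{n}Σ_{ℓ=1}^{k} i(i+1)r_{n,i,k}/(ℓ−½)^{i+2}`, `ρ_{n,3} = 384 Σ_{k=0}^{n} r_{n,3,k}`.
  *Proof.* By Definition 3.2 and (def_rik), `S_n = Σ_{i=1}^{4}Σ_{k=0}^{n} i r_{n,i,k} ∫_{ℤ₂} dt/(t+k+½)^{i+1}` (341).  By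
  Lemma 2.4 and Lemma 2.8, `∫_{ℤ₂} dt/(t+k+½)^{i+1} = ∫_{ℤ₂} dt/(t+½)^{i+1} − (i+1)Σ_{ℓ=1}^{k}(ℓ−½)^{−(i+2)} =
  (i+1)2^{i+2}ζ₂(i+2) − (i+1)Σ_{ℓ=1}^{k}(ℓ−½)^{−(i+2)}` (342).  Substituting, and using `ζ₂(s) = 0` for even `s`,
  `S_n = ρ_{n,0} + (16Σ_k r_{n,1,k})·ζ₂(3) + ρ_{n,3}·ζ₂(5)`.  By (def_rik) and (3.1), `Σ_k r_{n,1,k} = lim_{t→∞} tR_n(t) = 0`."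

## What is formalised (all PROVED)

* `sum_coeffR_one_eq_zero` — **`Σ_{k=0}^{n} r_{n,1,k} = 0`**, proved as printed: `N·R_n(N) → 0` (the bound
  `0 ≤ R_n(N) ≤ 2^{8n}(2N+n)/N⁴`, i.e. `deg R_n = −3`) while `N·(Σ_{k,i} r_{n,i,k}(N+k)^{−i}) → Σ_k r_{n,1,k}`.
* `Dq n x := Σ_{k,i} i·r_{n,i,k}·(x+k+½)^{−(i+1)}` (over `ℚ`) and `hasDerivAt_R_half` — **`R_n′(x+½) = −Dq n x`** off the
  poles (termwise differentiation of (def_rik)): the integrand of Definition 3.2 IS the partial-fraction expression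
  (341); `D n : ℤ₂ → ℚ₂` is the same expression 2-adically (`D_natCast`: `D n k = Dq n k` at every natural `k`), and
  **`S n := ∫_{ℤ₂} (D n)(t) dt`** (tree `LocalFields.volkenbornIntegral`) is Definition 3.2's `S_n = −∫R_n′(t+½)dt`.
* **Lemma 3.3**: `tendsto_volkenbornSum_D` — the Riemann sums of `D n` CONVERGE, to `ρ_{n,0} + ρ_{n,3}·ζ₂(5)` with
  `ρ_{n,0} = pfRho0 n`, `ρ_{n,3} = pfRho3 n` ((def_rho_0), (def_rho_3) of `PartialFractions.lean`) and `ζ₂(5) = padicZetaValue 2 5`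
  (Basic.lean); hence `S_eq_pfRho` and, through the tree's bridges `pfRho0_eq_rho0`/`pfRho3_eq_rho3`, **`lemma33`**:
  `S n = rho0 n + rho3 n · ζ₂(5)`.  Inputs: (342) = `PAdicZetaValues.tendsto_volkenbornSum_half_shift_zpow_neg`
  (Lemma 2.4 + Lemma 2.8, file `VolkenbornDeltaOperator.lean`), `ζ₂(4) = ζ₂(6) = 0` = `padicZetaValue_even`.

Remark 3.4 (the Archimedean shadow `Σ_m R_n″(m+½) = ρ_{n,0} + ρ_{n,3}(1−2^{−5})ζ(5)`) is not formalised.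
Cell zeta5-irr / pub-zeta5 (HONEST FRAMING: systematic search; no irrationality claim unless kernel-certified): `2`-adic
linear forms in `1, ζ₂(5)`; nothing here bears on `ζ(5) ∈ ℝ`.
-/

noncomputable section

open Filter Finset Topology
open Literature.NumberTheory.LocalFields
open Literature.NumberTheory.Irrationality.PAdicZetaValues

namespace Literature.NumberTheory.Irrationality.LaiSprangZudilin2026

/-! ## §1. `Σ_k r_{n,1,k} = lim_{t→∞} tR_n(t) = 0` (deg `R_n = −3`) -/

/-- `0 ≤ R_n(N)` and `R_n(N) ≤ 2^{8n}(2N+n)/N⁴` for a natural number `N ≥ 1` (each factor `N+½+j ≤ N+1+j`; in `ℝ`).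
[cite: LaiSprangZudilin2026, §3 (3.1) (`deg R_n = −3`)] -/
theorem R_natCast_bounds (n : ℕ) {N : ℕ} (hN : 1 ≤ N) :
    0 ≤ (R n N : ℝ) ∧ (R n N : ℝ) ≤ 2 ^ (8 * n) * (2 * N + n) / (N : ℝ) ^ 4 := by
  have hN0 : (0 : ℝ) < N := by exact_mod_cast hN
  have hcast : (R n N : ℝ) = 2 ^ (8 * n) * (2 * N + n) * (∏ j ∈ range n, ((N : ℝ) + 1 / 2 + j)) ^ 4 /
      (∏ j ∈ range (n + 1), ((N : ℝ) + j)) ^ 4 := by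
    rw [R]; push_cast; ring
  have hA0 : 0 ≤ ∏ j ∈ range n, ((N : ℝ) + 1 / 2 + j) := prod_nonneg fun j _ => by positivity
  have hB : ∏ j ∈ range (n + 1), ((N : ℝ) + j) = N * ∏ j ∈ range n, ((N : ℝ) + 1 + j) := by
    rw [Finset.prod_range_succ']
    push_cast
    rw [add_zero, mul_comm]
    congr 1
    exact prod_congr rfl fun j _ => by ring
  have hC0 : 0 < ∏ j ∈ range n, ((N : ℝ) + 1 + j) := prod_pos fun j _ => by positivity
  have hAC : ∏ j ∈ range n, ((N : ℝ) + 1 / 2 + j) ≤ ∏ j ∈ range n, ((N : ℝ) + 1 + j) :=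
    prod_le_prod (fun j _ => by positivity) fun j _ => by linarith
  rw [hcast, hB]
  constructor
  · positivity
  · rw [mul_pow, div_le_div_iff₀ (by positivity) (by positivity)]
    have h4 : (∏ j ∈ range n, ((N : ℝ) + 1 / 2 + j)) ^ 4 ≤ (∏ j ∈ range n, ((N : ℝ) + 1 + j)) ^ 4 :=
      pow_le_pow_left₀ hA0 hAC 4
    have hpos : (0 : ℝ) ≤ 2 ^ (8 * n) * (2 * N + n) := by positivity
    calc 2 ^ (8 * n) * (2 * (N : ℝ) + n) * (∏ j ∈ range n, ((N : ℝ) + 1 / 2 + j)) ^ 4 * (N : ℝ) ^ 4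
        ≤ 2 ^ (8 * n) * (2 * (N : ℝ) + n) * (∏ j ∈ range n, ((N : ℝ) + 1 + j)) ^ 4 * (N : ℝ) ^ 4 := by
          gcongr
      _ = 2 ^ (8 * n) * (2 * N + n) * ((N : ℝ) ^ 4 * (∏ j ∈ range n, ((N : ℝ) + 1 + j)) ^ 4) := by ring

/-- `N·R_n(N) → 0` as `N → ∞` ("`lim_{t→∞} tR_n(t) = 0`", from `deg R_n = −3`). [cite: LaiSprangZudilin2026, Lemma 3.3 (proof, last display)] -/
theorem tendsto_natCast_mul_R (n : ℕ) : Tendsto (fun N : ℕ => (N : ℝ) * (R n N : ℝ)) atTop (𝓝 0) := by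
  have hup : Tendsto (fun N : ℕ => (2 : ℝ) ^ (8 * n) * (2 + n) / (N : ℝ)) atTop (𝓝 0) :=
    tendsto_const_div_atTop_nhds_zero_nat _
  refine squeeze_zero' ?_ ?_ hup
  · filter_upwards [eventually_ge_atTop 1] with N hN
    exact mul_nonneg (Nat.cast_nonneg N) (R_natCast_bounds n hN).1
  · filter_upwards [eventually_ge_atTop 1] with N hN
    have hN0 : (0 : ℝ) < N := by exact_mod_cast hN
    have hN1 : (1 : ℝ) ≤ N := by exact_mod_cast hN
    have h := (R_natCast_bounds n hN).2
    have hkey : (2 * (N : ℝ) + n) / (N : ℝ) ^ 3 ≤ (2 + n) / (N : ℝ) := by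
      rw [div_le_div_iff₀ (by positivity) hN0]
      have hn0 : (0 : ℝ) ≤ n := Nat.cast_nonneg n
      have h1 : (n : ℝ) ≤ n * N := le_mul_of_one_le_right hn0 hN1
      have h2 : (N : ℝ) * N ≤ (N : ℝ) ^ 3 := by
        rw [show (N : ℝ) ^ 3 = N * N * N by ring]
        exact le_mul_of_one_le_right (by positivity) hN1
      nlinarith [mul_le_mul_of_nonneg_right h1 hN0.le, mul_le_mul_of_nonneg_left h2 (by positivity : (0:ℝ) ≤ 2 + n)]
    calc (N : ℝ) * (R n N : ℝ) ≤ N * (2 ^ (8 * n) * (2 * N + n) / (N : ℝ) ^ 4) :=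
          mul_le_mul_of_nonneg_left h hN0.le
      _ = 2 ^ (8 * n) * ((2 * N + n) / (N : ℝ) ^ 3) := by field_simp
      _ ≤ 2 ^ (8 * n) * ((2 + n) / (N : ℝ)) := mul_le_mul_of_nonneg_left hkey (by positivity)
      _ = 2 ^ (8 * n) * (2 + n) / (N : ℝ) := by ring

/-- **`Σ_{k=0}^{n} r_{n,1,k} = 0`** ("By (def_rik) and (3.1), `Σ_k r_{n,1,k} = lim_{t→∞} tR_n(t) = 0`").
[cite: LaiSprangZudilin2026, Lemma 3.3 (proof, last display)] -/
theorem sum_coeffR_one_eq_zero (n : ℕ) : ∑ k ∈ range (n + 1), coeffR n 1 k = 0 := by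
  -- the limit value of each partial fraction times `N`
  set L : ℕ → ℕ → ℝ := fun i k => if i = 1 then (coeffR n 1 k : ℝ) else 0 with hL
  have hterm : ∀ k ∈ range (n + 1), ∀ i ∈ (Icc 1 4 : Finset ℕ),
      Tendsto (fun N : ℕ => (N : ℝ) * ((coeffR n i k : ℝ) * (((N : ℝ) + k) ^ i)⁻¹)) atTop (𝓝 (L i k)) := by
    intro k _ i hi
    have hi1 : 1 ≤ i := (mem_Icc.1 hi).1
    -- `N/(N+k) → 1`
    have h1 : Tendsto (fun N : ℕ => (N : ℝ) / ((N : ℝ) + k)) atTop (𝓝 1) := tendsto_natCast_div_add_atTop (k : ℝ)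
    by_cases hi' : i = 1
    · subst hi'
      simp only [hL, if_true, pow_one]
      have := h1.const_mul (coeffR n 1 k : ℝ)
      rw [mul_one] at this
      refine this.congr fun N => ?_
      ring
    · simp only [hL, if_neg hi']
      obtain ⟨m, rfl⟩ : ∃ m, i = m + 2 := ⟨i - 2, by omega⟩
      -- `1/(N+k)^{m+1} → 0`
      have h2 : Tendsto (fun N : ℕ => (((N : ℝ) + k) ^ (m + 1))⁻¹) atTop (𝓝 0) := by
        have ht : Tendsto (fun N : ℕ => ((N : ℝ) + k) ^ (m + 1)) atTop atTop := by
          refine (tendsto_pow_atTop (by omega)).comp ?_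
          exact tendsto_atTop_add_const_right _ _ tendsto_natCast_atTop_atTop
        exact ht.inv_tendsto_atTop
      have h := (h1.mul h2).const_mul (coeffR n (m + 2) k : ℝ)
      rw [one_mul, mul_zero] at h
      refine h.congr' ?_
      filter_upwards [eventually_ge_atTop 1] with N hN
      have hNk : ((N : ℝ) + k) ≠ 0 := by positivity
      field_simp
      ring
  have hsum : Tendsto (fun N : ℕ => (N : ℝ) * ∑ k ∈ range (n + 1), ∑ i ∈ (Icc 1 4 : Finset ℕ),
      (coeffR n i k : ℝ) * (((N : ℝ) + k) ^ i)⁻¹) atTop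
      (𝓝 (∑ k ∈ range (n + 1), ∑ i ∈ (Icc 1 4 : Finset ℕ), L i k)) := by
    have h := tendsto_finsetSum (range (n + 1)) fun k hk =>
      tendsto_finsetSum (Icc 1 4 : Finset ℕ) fun i hi => hterm k hk i hi
    refine h.congr fun N => ?_
    rw [mul_sum]
    exact sum_congr rfl fun k _ => by rw [mul_sum]
  have hLsum : ∑ k ∈ range (n + 1), ∑ i ∈ (Icc 1 4 : Finset ℕ), L i k = ((∑ k ∈ range (n + 1), coeffR n 1 k : ℚ) : ℝ) := by
    push_cast
    refine sum_congr rfl fun k _ => ?_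
    rw [show (Icc 1 4 : Finset ℕ) = {1, 2, 3, 4} by decide]
    simp [hL]
  -- the two expressions agree for `N ≥ 1`
  have heq : ∀ᶠ N : ℕ in atTop, (N : ℝ) * (R n N : ℝ) =
      (N : ℝ) * ∑ k ∈ range (n + 1), ∑ i ∈ (Icc 1 4 : Finset ℕ), (coeffR n i k : ℝ) * (((N : ℝ) + k) ^ i)⁻¹ := by
    filter_upwards [eventually_ge_atTop 1] with N hN
    have hne : ∀ j ∈ range (n + 1), (N : ℚ) + j ≠ 0 := fun j _ => by positivity
    rw [R_eq_sum_coeffR n hne]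
    push_cast
    rfl
  have hlim := (tendsto_natCast_mul_R n).congr' heq
  have huniq := tendsto_nhds_unique hlim hsum
  rw [hLsum] at huniq
  exact_mod_cast huniq.symm

/-! ## §2. Definition 3.2: the integrand `−R_n′(t+½)` in partial fractions, and `S_n` -/

/-- The partial-fraction form of `−R_n′(x+½)`: `Dq n x = Σ_{k=0}^{n} Σ_{i=1}^{4} i·r_{n,i,k}·(x+k+½)^{−(i+1)}` (over `ℚ`;
the termwise derivative of (def_rik), see `hasDerivAt_R_half`). [cite: LaiSprangZudilin2026, Lemma 3.3 (proof, display (341))] -/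
def Dq (n : ℕ) (x : ℚ) : ℚ :=
  ∑ k ∈ range (n + 1), ∑ i ∈ (Icc 1 4 : Finset ℕ), (i : ℚ) * coeffR n i k * ((x + k + 1 / 2) ^ (i + 1))⁻¹

/-- **`R_n′(x+½) = −Dq n x`** off the poles: the derivative of the partial-fraction expansion (def_rik) is taken termwise,
`d/dt (t+k)^{−i} = −i(t+k)^{−(i+1)}`. [cite: LaiSprangZudilin2026, Definition 3.2 and Lemma 3.3 (proof, (341))] -/
theorem hasDerivAt_R_half (n : ℕ) {x : ℚ} (hx : ∀ j ∈ range (n + 1), x + 1 / 2 + j ≠ 0) :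
    HasDerivAt (R n) (-Dq n x) (x + 1 / 2) := by
  have hgerm : R n =ᶠ[𝓝 (x + 1 / 2)]
      fun t => ∑ k ∈ range (n + 1), ∑ i ∈ (Icc 1 4 : Finset ℕ), coeffR n i k * ((t + k) ^ i)⁻¹ :=
    (eventually_nhds_forall_add_ne_zero (range (n + 1)) hx).mono fun t ht => R_eq_sum_coeffR n ht
  refine HasDerivAt.congr_of_eventuallyEq ?_ hgerm
  have hterm : ∀ k ∈ range (n + 1), ∀ i ∈ (Icc 1 4 : Finset ℕ),
      HasDerivAt (fun t : ℚ => coeffR n i k * ((t + k) ^ i)⁻¹)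
        (-((i : ℚ) * coeffR n i k * ((x + k + 1 / 2) ^ (i + 1))⁻¹)) (x + 1 / 2) := by
    intro k hk i hi
    have hu : x + 1 / 2 + k ≠ 0 := hx k hk
    obtain ⟨m, rfl⟩ : ∃ m, i = m + 1 := ⟨i - 1, by have := (mem_Icc.1 hi).1; omega⟩
    have hpow : HasDerivAt (fun t : ℚ => (t + k) ^ (m + 1)) (((m + 1 : ℕ) : ℚ) * (x + 1 / 2 + k) ^ (m + 1 - 1) * 1)
        (x + 1 / 2) := ((hasDerivAt_id _).add_const (k : ℚ)).pow (m + 1)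
    have hinv : HasDerivAt (fun t : ℚ => ((t + k) ^ (m + 1))⁻¹)
        (-(((m + 1 : ℕ) : ℚ) * (x + 1 / 2 + k) ^ (m + 1 - 1) * 1) / ((x + 1 / 2 + k) ^ (m + 1)) ^ 2) (x + 1 / 2) :=
      hpow.inv (pow_ne_zero _ hu)
    have h := hinv.const_mul (coeffR n (m + 1) k)
    refine h.congr_deriv ?_
    rw [Nat.add_sub_cancel, show x + k + 1 / 2 = x + 1 / 2 + k by ring]
    set u : ℚ := x + 1 / 2 + k with hu_def
    have hum : u ^ m ≠ 0 := pow_ne_zero _ hu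
    have hum1 : u ^ (m + 1) ≠ 0 := pow_ne_zero _ hu
    have hum2 : u ^ (m + 1 + 1) ≠ 0 := pow_ne_zero _ hu
    push_cast
    field_simp
    ring
  have hsum := HasDerivAt.sum fun k hk => HasDerivAt.sum fun i hi => hterm k hk i hi
  simp only [sum_neg_distrib] at hsum
  convert hsum using 1
  · funext t; simp [Finset.sum_apply]
  · rw [Dq, ← sum_neg_distrib]

/-- The integrand of Definition 3.2 as a function on `ℤ₂`: **`D n t = −R_n′(t+½)`** written via (341),
`D n t = Σ_{k,i} i r_{n,i,k} (t+k+½)^{−(i+1)}` in `ℚ₂` (the poles `−k−½` lie outside `ℤ₂`).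
[cite: LaiSprangZudilin2026, Definition 3.2 with Lemma 3.3 (341)] -/
def D (n : ℕ) (t : ℤ_[2]) : ℚ_[2] :=
  ∑ k ∈ range (n + 1), ∑ i ∈ (Icc 1 4 : Finset ℕ),
    (((i : ℚ) * coeffR n i k : ℚ) : ℚ_[2]) * ((t : ℚ_[2]) + k + 1 / 2) ^ (-((i : ℤ) + 1))

/-- At natural numbers the 2-adic integrand is the rational number `Dq n k = −R_n′(k+½)` (cast compatibility).
[cite: LaiSprangZudilin2026, Definition 3.2] -/
theorem D_natCast (n k : ℕ) : D n (k : ℤ_[2]) = ((Dq n k : ℚ) : ℚ_[2]) := by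
  rw [D, Dq]
  push_cast
  refine sum_congr rfl fun j _ => sum_congr rfl fun i _ => ?_
  rw [show (-((i : ℤ) + 1)) = -((i + 1 : ℕ) : ℤ) by push_cast; ring, zpow_neg, zpow_natCast]

/-- **Definition 3.2**: `S_n := −∫_{ℤ₂} R_n′(t+½) dt = ∫_{ℤ₂} D_n(t) dt` (tree `volkenbornIntegral`; the Riemann sums converge,
`tendsto_volkenbornSum_D`). [cite: LaiSprangZudilin2026, Definition 3.2] -/
def S (n : ℕ) : ℚ_[2] := volkenbornIntegral 2 (D n)

/-! ## §3. Lemma 3.3 -/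

/-- `H_s(k) = Σ_{ℓ=1}^{k}(ℓ−½)^{−s} = Σ_{ℓ<k}(ℓ+½)^{−s}` (index shift). [cite: LaiSprangZudilin2026, Lemma 3.3 (def_rho_0)] -/
theorem halfInvPowSum_eq_sum_range (s k : ℕ) :
    halfInvPowSum s k = ∑ ℓ ∈ range k, (((ℓ : ℚ) + 1 / 2) ^ s)⁻¹ := by
  induction k with
  | zero => simp
  | succ k ih => rw [Finset.sum_range_succ, ← ih, ← halfInvPowSum_succ_sub s k]; ring

/-- The Riemann sums of `D_n` as the combination (341) of the Riemann sums of `(t+k+½)^{−(i+1)}`.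
[cite: LaiSprangZudilin2026, Lemma 3.3 (proof, (341))] -/
theorem volkenbornSum_D (n N : ℕ) : volkenbornSum 2 (D n) N =
    ∑ k ∈ range (n + 1), ∑ i ∈ (Icc 1 4 : Finset ℕ), (((i : ℚ) * coeffR n i k : ℚ) : ℚ_[2]) *
      volkenbornSum 2 (fun t : ℤ_[2] => ((t : ℚ_[2]) + k + 1 / 2) ^ (-((i : ℤ) + 1))) N := by
  set f : ℕ → ℕ → ℤ_[2] → ℚ_[2] := fun i k t => ((t : ℚ_[2]) + k + 1 / 2) ^ (-((i : ℤ) + 1)) with hf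
  set G : ℕ → ℤ_[2] → ℚ_[2] := fun k t => ∑ i ∈ (Icc 1 4 : Finset ℕ),
    (fun (i : ℕ) (t : ℤ_[2]) => (((i : ℚ) * coeffR n i k : ℚ) : ℚ_[2]) • f i k t) i t with hG
  have hD : D n = fun t => ∑ k ∈ range (n + 1), G k t := by
    funext t
    simp only [D, hG, hf, smul_eq_mul]
  rw [hD, volkenbornSum_finset_sum]
  refine sum_congr rfl fun k _ => ?_
  rw [hG, volkenbornSum_finset_sum]
  refine sum_congr rfl fun i _ => ?_
  rw [volkenbornSum_smul, smul_eq_mul]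

/-- **Lemma 3.3 (the limit):** the Riemann sums of `D_n = −R_n′(·+½)` converge `2`-adically to `ρ_{n,0} + ρ_{n,3}·ζ₂(5)`
(with (342): `∫(t+k+½)^{−(i+1)} = (i+1)2^{i+2}ζ₂(i+2) − (i+1)H_{i+2}(k)`; `ζ₂(4) = ζ₂(6) = 0`; `Σ_k r_{n,1,k} = 0`).
[cite: LaiSprangZudilin2026, Lemma 3.3] -/
theorem tendsto_volkenbornSum_D (n : ℕ) :
    Tendsto (volkenbornSum 2 (D n)) atTop
      (𝓝 (((pfRho0 n : ℚ) : ℚ_[2]) + ((pfRho3 n : ℚ) : ℚ_[2]) * padicZetaValue 2 5)) := by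
  -- termwise limits (342)
  set A : ℕ → ℚ_[2] := fun i => ((i : ℚ_[2]) + 1) * 2 ^ (i + 2) * padicZetaValue 2 (i + 2) with hA
  set B : ℕ → ℕ → ℚ_[2] := fun i k => ∑ ℓ ∈ range k, -((i : ℚ_[2]) + 1) * (((ℓ : ℚ_[2]) + 1 / 2) ^ (i + 2))⁻¹ with hB
  have hterm : ∀ k i : ℕ, Tendsto (volkenbornSum 2 (fun t : ℤ_[2] => ((t : ℚ_[2]) + k + 1 / 2) ^ (-((i : ℤ) + 1))))
      atTop (𝓝 (A i + B i k)) := fun k i => tendsto_volkenbornSum_half_shift_zpow_neg i k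
  have hlim : Tendsto (volkenbornSum 2 (D n)) atTop (𝓝 (∑ k ∈ range (n + 1), ∑ i ∈ (Icc 1 4 : Finset ℕ),
      (((i : ℚ) * coeffR n i k : ℚ) : ℚ_[2]) * (A i + B i k))) := by
    have h := tendsto_finsetSum (range (n + 1)) fun k (_ : k ∈ range (n + 1)) =>
      tendsto_finsetSum (Icc 1 4 : Finset ℕ) fun i (_ : i ∈ (Icc 1 4 : Finset ℕ)) =>
        (hterm k i).const_mul (((i : ℚ) * coeffR n i k : ℚ) : ℚ_[2])
    refine h.congr fun N => ?_
    rw [volkenbornSum_D]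
  -- evaluate the limit
  have hBsum : ∑ k ∈ range (n + 1), ∑ i ∈ (Icc 1 4 : Finset ℕ), (((i : ℚ) * coeffR n i k : ℚ) : ℚ_[2]) * B i k =
      ((pfRho0 n : ℚ) : ℚ_[2]) := by
    rw [pfRho0_eq_sum_halfInvPowSum]
    push_cast
    rw [← sum_neg_distrib]
    refine sum_congr rfl fun k _ => ?_
    rw [← sum_neg_distrib]
    refine sum_congr rfl fun i _ => ?_
    rw [hB, halfInvPowSum_eq_sum_range]
    dsimp only
    push_cast
    rw [mul_sum, mul_sum, ← sum_neg_distrib]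
    refine sum_congr rfl fun ℓ _ => ?_
    ring
  have hAsum : ∑ k ∈ range (n + 1), ∑ i ∈ (Icc 1 4 : Finset ℕ), (((i : ℚ) * coeffR n i k : ℚ) : ℚ_[2]) * A i =
      ((pfRho3 n : ℚ) : ℚ_[2]) * padicZetaValue 2 5 := by
    rw [Finset.sum_comm]
    have hi : ∀ i ∈ (Icc 1 4 : Finset ℕ), ∑ k ∈ range (n + 1), (((i : ℚ) * coeffR n i k : ℚ) : ℚ_[2]) * A i =
        ((i : ℚ_[2]) * A i) * (((∑ k ∈ range (n + 1), coeffR n i k : ℚ)) : ℚ_[2]) := by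
      intro i _
      push_cast
      rw [mul_sum]
      exact sum_congr rfl fun k _ => by ring
    rw [sum_congr rfl hi, show (Icc 1 4 : Finset ℕ) = {1, 2, 3, 4} by decide]
    rw [sum_insert (by decide), sum_insert (by decide), sum_insert (by decide), sum_singleton]
    have h4 : padicZetaValue 2 (2 + 2) = 0 := padicZetaValue_even (p := 2) ⟨2, rfl⟩ (by norm_num)
    have h6 : padicZetaValue 2 (4 + 2) = 0 := padicZetaValue_even (p := 2) ⟨3, rfl⟩ (by norm_num)
    rw [sum_coeffR_one_eq_zero, hA]
    dsimp only
    rw [h4, h6, pfRho3]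
    push_cast
    ring
  have hval : ∑ k ∈ range (n + 1), ∑ i ∈ (Icc 1 4 : Finset ℕ), (((i : ℚ) * coeffR n i k : ℚ) : ℚ_[2]) * (A i + B i k) =
      ((pfRho0 n : ℚ) : ℚ_[2]) + ((pfRho3 n : ℚ) : ℚ_[2]) * padicZetaValue 2 5 := by
    rw [← hAsum, ← hBsum, ← sum_add_distrib]
    refine sum_congr rfl fun k _ => ?_
    rw [← sum_add_distrib]
    exact sum_congr rfl fun i _ => by ring
  rw [← hval]
  exact hlim

/-- **Lemma 3.3** in the printed partial-fraction vocabulary: `S_n = ρ_{n,0} + ρ_{n,3}·ζ₂(5)` with `ρ_{n,0}`, `ρ_{n,3}` the sums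
(def_rho_0), (def_rho_3). [cite: LaiSprangZudilin2026, Lemma 3.3] -/
theorem S_eq_pfRho (n : ℕ) :
    S n = ((pfRho0 n : ℚ) : ℚ_[2]) + ((pfRho3 n : ℚ) : ℚ_[2]) * padicZetaValue 2 5 :=
  volkenbornIntegral_eq (tendsto_volkenbornSum_D n)

/-- **Lemma 3.3** with the tree's recurrence-defined `ρ_{n,0} = rho0 n`, `ρ_{n,3} = rho3 n` (`SecondSolution.lean`; equal to
(def_rho_0), (def_rho_3) by `pfRho0_eq_rho0`, `pfRho3_eq_rho3`): **`S_n = ρ_{n,0} + ρ_{n,3}·ζ₂(5)`**.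
[cite: LaiSprangZudilin2026, Lemma 3.3] -/
theorem lemma33 (n : ℕ) :
    S n = ((rho0 n : ℚ) : ℚ_[2]) + ((rho3 n : ℚ) : ℚ_[2]) * padicZetaValue 2 5 := by
  rw [S_eq_pfRho, pfRho0_eq_rho0, pfRho3_eq_rho3]

/-- The Riemann sums of `D_n` tend to `S_n`. [cite: LaiSprangZudilin2026, Definition 3.2] -/
theorem tendsto_volkenbornSum_D_S (n : ℕ) : Tendsto (volkenbornSum 2 (D n)) atTop (𝓝 (S n)) := by
  rw [S_eq_pfRho]; exact tendsto_volkenbornSum_D n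

end Literature.NumberTheory.Irrationality.LaiSprangZudilin2026
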